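import Mathlib
import Summits.KontsevichZagierPeriods.Zeta5Search.CasoratianClassBoundShift
import Summits.KontsevichZagierPeriods.Zeta5Search.RecordCellAtlas
import HarnessLib

/-!
# ζ(5) search — the class atlas of the CONSECUTIVE FAMILY `b = n·(3t+8; t+6,…,t)` at the primes `(t+3)n < p < (t+4)n`

Cell `pub-zeta5` (HONEST FRAMING: systematic search; no irrationality claim unless certified), P1 prover seat
generation 5; the combinatorial half of the Lean proof of census g11's `FamilyCellA` (the one-parameter family through the
Brown–Zudilin record, `t = 11`; NEAR-MISSES rows 2, 3 are `t = 12, 14`).  Verbatim generalisation of `RecordCellAAtlas.lean`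
(`11n ↦ tn`, `41n ↦ (3t+8)n`; every bound is linear in `m = t·n` and `n`): for `t ≥ 4`, `n ≥ 1` and `(t+3)n < p < (t+4)n`
(`3p > (3t+8)n`):

* the parameters and the polytope (`bFam_val…`, `inPolytope_bFam`, `inPolytope_shift_bFam`);
* the depth / net-exponent table (`depF`, `blockCount_bFam`, `netExp_bFam`), unchanged by `b ↦ b + e₇` away from `tn`,
  `(2t+8)n` (`netExp_shiftF7`); the classes (`classSet_bFam`);
* the minimal multipole classes `FMinA` (type `(−1,−3)`), `FMinS` (type `(−2,−2)`, not self-conjugate), `FMinAbar`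
  (type `(−3,−1)`, the conjugates `(3t+8)n − x − p` of `FMinA`) with their net exponents.
Part 2 (`FamilyCellAAtlasNotMin.lean`): every other class has `ν_x ≥ −3`.  Paper statement and exact check for `t ≤ 24`:
gen-2 g9, REPORT-gen2-g9 §2.2; census g11 `famtest_all.py` (103/103).  Nothing about irrationality.
-/

open Finset

namespace Summit.KontsevichZagierPeriods.Zeta5Search.CellA

open Summit.KontsevichZagierPeriods.Zeta5Search.ClusterValuation
open Summit.KontsevichZagierPeriods.Zeta5Search.CasoratianValuation (shift InPolytope)
open Summit.KontsevichZagierPeriods.Zeta5Search.BigPrime (block shift_zero)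
open Summit.KontsevichZagierPeriods.Zeta5Search.CellAtlas (bFam)

/-! ### §1 The parameters of the family and the polytope -/

/-- `b₀ = (3t+8)n = 3·tn + 8n`. -/
theorem bFam_val0 (t n : ℕ) : bFam t n 0 = ((3 * (t * n) + 8 * n : ℕ) : ℤ) := by simp [bFam]; ring

/-- `b_{j+1} = (t+6−j)n = tn + (6−j)n` for `j < 7`. -/
theorem bFam_val_succ (t n j : ℕ) (hj : j < 7) : bFam t n (j + 1) = ((t * n + (6 - j) * n : ℕ) : ℤ) := by
  interval_cases j <;> simp [bFam] <;> ring

/-- Beyond the eight slots the vector is `0`. -/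
theorem bFam_val_high (t n k : ℕ) : bFam t n (k + 8) = 0 := by simp [bFam]

/-- `b₀` as a natural number. -/
theorem bFam_zero_toNat (t n : ℕ) : (bFam t n 0).toNat = 3 * (t * n) + 8 * n := by
  rw [bFam_val0, Int.toNat_natCast]

/-- `b_{j+1}` as a natural number. -/
theorem bFam_succ_toNat (t n j : ℕ) (hj : j < 7) : (bFam t n (j + 1)).toNat = t * n + (6 - j) * n := by
  rw [bFam_val_succ t n j hj, Int.toNat_natCast]

/-- The family lies in the Brown–Zudilin polytope for `t ≥ 4`. -/
theorem inPolytope_bFam {t : ℕ} (ht : 4 ≤ t) (n : ℕ) : InPolytope (bFam t n) := by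
  have h4 : ((4 * n : ℕ) : ℤ) ≤ ((t * n : ℕ) : ℤ) := by exact_mod_cast Nat.mul_le_mul_right n ht
  have h6 : ∀ j : ℕ, (((6 - j) * n : ℕ) : ℤ) ≤ ((6 * n : ℕ) : ℤ) := fun j => by
    exact_mod_cast Nat.mul_le_mul_right n (by omega : 6 - j ≤ 6)
  refine ⟨⟨by rw [bFam_val0]; positivity, fun j hj => ?_⟩, fun j hj => ?_, ?_⟩
  · rw [mem_range] at hj
    rw [bFam_val_succ t n j hj, bFam_val0]
    have := h6 j; push_cast at h4 this ⊢; constructor <;> nlinarith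
  · rw [mem_range] at hj
    rw [bFam_val_succ t n j hj, bFam_val0]
    have := h6 j; push_cast at h4 this ⊢
    nlinarith
  · simp only [sum_range_succ, sum_range_zero, zero_add]
    rw [bFam_val_succ t n 0 (by norm_num), bFam_val_succ t n 1 (by norm_num), bFam_val_succ t n 2 (by norm_num),
      bFam_val_succ t n 3 (by norm_num), bFam_val_succ t n 4 (by norm_num), bFam_val_succ t n 5 (by norm_num),
      bFam_val_succ t n 6 (by norm_num), bFam_val0]
    push_cast at h4 ⊢; nlinarith

/-- So does `b + e₇` (for `n ≥ 1`). -/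
theorem inPolytope_shift_bFam {t : ℕ} (ht : 4 ≤ t) {n : ℕ} (hn : 1 ≤ n) : InPolytope (shift (bFam t n) 7) := by
  have h4 : ((4 * n : ℕ) : ℤ) ≤ ((t * n : ℕ) : ℤ) := by exact_mod_cast Nat.mul_le_mul_right n ht
  have h6 : ∀ j : ℕ, (((6 - j) * n : ℕ) : ℤ) ≤ ((6 * n : ℕ) : ℤ) := fun j => by
    exact_mod_cast Nat.mul_le_mul_right n (by omega : 6 - j ≤ 6)
  have h7 : shift (bFam t n) 7 7 = bFam t n 7 + 1 := by simp [shift]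
  have hne : ∀ i, i ≠ 7 → shift (bFam t n) 7 i = bFam t n i := fun i hi => by
    simp [shift, Function.update_of_ne hi]
  refine ⟨⟨by rw [hne 0 (by norm_num), bFam_val0]; positivity, fun j hj => ?_⟩, fun j hj => ?_, ?_⟩
  · rw [mem_range] at hj
    rw [hne 0 (by norm_num), bFam_val0]
    by_cases hj6 : j = 6
    · subst hj6; rw [show (6:ℕ) + 1 = 7 from rfl, h7, bFam_val_succ t n 6 (by norm_num)]
      push_cast at h4 ⊢; constructor <;> nlinarith
    · rw [hne (j + 1) (by omega), bFam_val_succ t n j hj]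
      have := h6 j; push_cast at h4 this ⊢; constructor <;> nlinarith
  · rw [mem_range] at hj
    rw [hne 0 (by norm_num), bFam_val0]
    by_cases hj6 : j = 6
    · subst hj6; rw [show (6:ℕ) + 1 = 7 from rfl, h7, bFam_val_succ t n 6 (by norm_num)]
      push_cast at h4 ⊢; nlinarith
    · rw [hne (j + 1) (by omega), bFam_val_succ t n j hj]
      have := h6 j; push_cast at h4 this ⊢
      nlinarith
  · simp only [sum_range_succ, sum_range_zero, zero_add]
    rw [hne 1 (by norm_num), hne 2 (by norm_num), hne 3 (by norm_num), hne 4 (by norm_num), hne 5 (by norm_num),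
      hne 6 (by norm_num), show (6:ℕ) + 1 = 7 from rfl, h7, hne 0 (by norm_num),
      bFam_val_succ t n 0 (by norm_num), bFam_val_succ t n 1 (by norm_num), bFam_val_succ t n 2 (by norm_num),
      bFam_val_succ t n 3 (by norm_num), bFam_val_succ t n 4 (by norm_num), bFam_val_succ t n 5 (by norm_num),
      bFam_val_succ t n 6 (by norm_num), bFam_val0]
    push_cast at h4 ⊢; nlinarith

/-! ### §2 The depth table -/

/-- The depth of `q` as an indicator sum over the seven blocks `[tn + kn, 2tn + (8−k)n]`, `k = 6,…,0`. -/
def depF (t n q : ℕ) : ℕ :=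
  (if t * n + 6 * n ≤ q ∧ q ≤ 2 * (t * n) + 2 * n then 1 else 0) +
  (if t * n + 5 * n ≤ q ∧ q ≤ 2 * (t * n) + 3 * n then 1 else 0) +
  (if t * n + 4 * n ≤ q ∧ q ≤ 2 * (t * n) + 4 * n then 1 else 0) +
  (if t * n + 3 * n ≤ q ∧ q ≤ 2 * (t * n) + 5 * n then 1 else 0) +
  (if t * n + 2 * n ≤ q ∧ q ≤ 2 * (t * n) + 6 * n then 1 else 0) +
  (if t * n + 1 * n ≤ q ∧ q ≤ 2 * (t * n) + 7 * n then 1 else 0) +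
  (if t * n + 0 * n ≤ q ∧ q ≤ 2 * (t * n) + 8 * n then 1 else 0)

/-- **`blockCount (bFam t n) q = depF t n q`.** -/
theorem blockCount_bFam (t n q : ℕ) : blockCount (bFam t n) q = depF t n q := by
  unfold blockCount depF
  rw [card_filter, bFam_zero_toNat]
  simp only [sum_range_succ, sum_range_zero, zero_add, block, mem_Icc]
  rw [bFam_succ_toNat t n 0 (by norm_num), bFam_succ_toNat t n 1 (by norm_num), bFam_succ_toNat t n 2 (by norm_num),
    bFam_succ_toNat t n 3 (by norm_num), bFam_succ_toNat t n 4 (by norm_num), bFam_succ_toNat t n 5 (by norm_num),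
    bFam_succ_toNat t n 6 (by norm_num)]
  have e : ∀ k : ℕ, k ≤ 6 → 3 * (t * n) + 8 * n - (t * n + (6 - k) * n) = 2 * (t * n) + (2 + k) * n := by
    intro k hk; interval_cases k <;> omega
  rw [e 0 (by norm_num), e 1 (by norm_num), e 2 (by norm_num), e 3 (by norm_num), e 4 (by norm_num), e 5 (by norm_num),
    e 6 (by norm_num)]

/-- **Net exponents on the family**: `netExp (bFam t n) q = 1 − depF + [2q = (3t+8)n]`. -/
theorem netExp_bFam (t n q : ℕ) :
    netExp (bFam t n) q = 1 - (depF t n q : ℤ) + (if 2 * q = 3 * (t * n) + 8 * n then 1 else 0) := by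
  unfold netExp
  rw [blockCount_bFam, bFam_val0]
  have : (2 * (q : ℤ) = ((3 * (t * n) + 8 * n : ℕ) : ℤ)) ↔ 2 * q = 3 * (t * n) + 8 * n := by omega
  simp only [this]

/-- Net exponent away from the centre. -/
theorem netExp_bFam_of_ne (t n q : ℕ) (hc : 2 * q ≠ 3 * (t * n) + 8 * n) :
    netExp (bFam t n) q = 1 - (depF t n q : ℤ) := by
  rw [netExp_bFam, if_neg hc, add_zero]

/-- Below all blocks. -/
theorem depF_low {t n q : ℕ} (h : q < t * n) : depF t n q = 0 := by
  unfold depF; split_ifs <;> omega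

/-- Above all blocks. -/
theorem depF_high {t n q : ℕ} (h : 2 * (t * n) + 8 * n < q) : depF t n q = 0 := by
  unfold depF; split_ifs <;> omega

/-- Lower side: `k` blocks contain `q ∈ [tn + (k−1)n, tn + kn)` for `1 ≤ k ≤ 4`. -/
theorem depF_lower {t n q k : ℕ} (hk1 : 1 ≤ k) (hk : k ≤ 4) (h1 : t * n + (k - 1) * n ≤ q) (h2 : q < t * n + k * n) :
    depF t n q = k := by
  interval_cases k <;> unfold depF <;> split_ifs <;> omega

/-- Upper side: `k` blocks contain `q ∈ (2tn + (8−k)n, 2tn + (9−k)n]` for `1 ≤ k ≤ 4`. -/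
theorem depF_upper {t n q k : ℕ} (hk1 : 1 ≤ k) (hk : k ≤ 4) (h1 : 2 * (t * n) + (8 - k) * n < q)
    (h2 : q ≤ 2 * (t * n) + (9 - k) * n) : depF t n q = k := by
  interval_cases k <;> unfold depF <;> split_ifs <;> omega

/-- At least four blocks on `[tn + 3n, 2tn + 5n]`. -/
theorem four_le_depF {t n q : ℕ} (h1 : t * n + 3 * n ≤ q) (h2 : q ≤ 2 * (t * n) + 5 * n) : 4 ≤ depF t n q := by
  unfold depF; split_ifs <;> omega

/-! ### §3 The shifted vector `b + e₇` -/

/-- `(b + e₇)₀ = b₀`. -/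
theorem shiftF7_zero_toNat (t n : ℕ) : (shift (bFam t n) 7 0).toNat = 3 * (t * n) + 8 * n := by
  rw [shift_zero _ (by norm_num), bFam_zero_toNat]

/-- Away from `tn` and `2tn + 8n` the shift does not change the depth. -/
theorem blockCount_shiftF7 (t n q : ℕ) (h1 : q ≠ t * n) (h2 : q ≠ 2 * (t * n) + 8 * n) :
    blockCount (shift (bFam t n) 7) q = blockCount (bFam t n) q := by
  unfold blockCount
  rw [shift_zero _ (by norm_num)]
  congr 1
  ext j
  simp only [mem_filter, mem_range, and_congr_right_iff]
  intro hj
  by_cases hj6 : j = 6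
  · subst hj6
    have e7 : shift (bFam t n) 7 7 = bFam t n 7 + 1 := by simp [shift]
    rw [show (6 : ℕ) + 1 = 7 from rfl, e7, bFam_zero_toNat]
    have h7 : (bFam t n 7).toNat = t * n := by have := bFam_succ_toNat t n 6 (by norm_num); simpa using this
    have h7' : (bFam t n 7 + 1).toNat = t * n + 1 := by
      rw [show (7 : ℕ) = 6 + 1 from rfl, bFam_val_succ t n 6 (by norm_num)]; omega
    rw [h7, h7']
    simp only [block, mem_Icc]
    omega
  · have : shift (bFam t n) 7 (j + 1) = bFam t n (j + 1) := by
      simp [shift, Function.update_of_ne (show j + 1 ≠ 7 by omega)]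
    rw [this]

/-- **`netExp (b+e₇) q = netExp b q`** for `q ∉ {tn, 2tn+8n}`. -/
theorem netExp_shiftF7 (t n q : ℕ) (h1 : q ≠ t * n) (h2 : q ≠ 2 * (t * n) + 8 * n) :
    netExp (shift (bFam t n) 7) q = netExp (bFam t n) q := by
  unfold netExp
  rw [blockCount_shiftF7 t n q h1 h2, shift_zero _ (by norm_num)]

/-! ### §4 The residue classes for `(t+3)n < p < (t+4)n` -/

section Classes

variable {t n p : ℕ} (hp : t * n + 3 * n < p) (hp' : p < t * n + 4 * n)

include hp hp' in
/-- **The class of `x < p`**: `{x, x+p, x+2p}` if `x + 2p ≤ b₀`, else `{x, x+p}`. -/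
theorem classSet_bFam {x : ℕ} (hx : x < p) :
    classSet (bFam t n) p x =
      if x + 2 * p ≤ 3 * (t * n) + 8 * n then {x, x + p, x + 2 * p} else {x, x + p} := by
  ext s
  rw [mem_classSet_iff, bFam_zero_toNat]
  have key : (s ≤ 3 * (t * n) + 8 * n ∧ (p : ℤ) ∣ (s : ℤ) - x) ↔
      (s = x ∨ s = x + p ∨ (s = x + 2 * p ∧ x + 2 * p ≤ 3 * (t * n) + 8 * n)) := by
    constructor
    · rintro ⟨hs, k, hk⟩
      have hk0 : 0 ≤ k := by
        by_contra hneg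
        push Not at hneg
        have : (p : ℤ) * k ≤ (p : ℤ) * (-1) := mul_le_mul_of_nonneg_left (by omega) (by omega)
        omega
      have hk3 : k < 3 := by
        by_contra hge
        push Not at hge
        have : (p : ℤ) * 3 ≤ (p : ℤ) * k := mul_le_mul_of_nonneg_left hge (by omega)
        omega
      interval_cases k <;> omega
    · rintro (rfl | rfl | ⟨rfl, h⟩)
      · exact ⟨by omega, 0, by ring⟩
      · exact ⟨by omega, 1, by push_cast; ring⟩
      · exact ⟨h, 2, by push_cast; ring⟩
  rw [key]
  split_ifs with h3
  · simp only [mem_insert, mem_singleton]; tauto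
  · simp only [mem_insert, mem_singleton]
    constructor
    · rintro (h | h | ⟨h, h'⟩)
      · exact Or.inl h
      · exact Or.inr h
      · exact absurd h' h3
    · rintro (h | h)
      · exact Or.inl h
      · exact Or.inr (Or.inl h)

end Classes

/-! ### §5 The minimal multipole classes -/

/-- Type `(−1,−3)`. -/
def FMinA (t n p : ℕ) : Finset ℕ :=
  (range p).filter fun x => t * n + n ≤ x ∧ x + p ≤ 2 * (t * n) + 5 * n ∧ 3 * (t * n) + 8 * n < x + 2 * p

/-- Type `(−2,−2)`, not self-conjugate. -/
def FMinS (t n p : ℕ) : Finset ℕ :=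
  (range p).filter fun x => t * n + 2 * n ≤ x ∧ x + p ≤ 2 * (t * n) + 6 * n ∧ 2 * x + p ≠ 3 * (t * n) + 8 * n

/-- Type `(−3,−1)` (the conjugates of `FMinA`). -/
def FMinAbar (t n p : ℕ) : Finset ℕ := (range p).filter fun x => t * n + 3 * n ≤ x ∧ x + p ≤ 2 * (t * n) + 7 * n

/-- All minimal multipole classes. -/
def FMinAll (t n p : ℕ) : Finset ℕ := FMinA t n p ∪ FMinS t n p ∪ FMinAbar t n p

/-- Membership in `FMinA`. -/
theorem mem_fminA {t n p x : ℕ} :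
    x ∈ FMinA t n p ↔ x < p ∧ t * n + n ≤ x ∧ x + p ≤ 2 * (t * n) + 5 * n ∧ 3 * (t * n) + 8 * n < x + 2 * p := by
  simp [FMinA]

/-- Membership in `FMinS`. -/
theorem mem_fminS {t n p x : ℕ} :
    x ∈ FMinS t n p ↔ x < p ∧ t * n + 2 * n ≤ x ∧ x + p ≤ 2 * (t * n) + 6 * n ∧ 2 * x + p ≠ 3 * (t * n) + 8 * n := by
  simp [FMinS]

/-- Membership in `FMinAbar`. -/
theorem mem_fminAbar {t n p x : ℕ} : x ∈ FMinAbar t n p ↔ x < p ∧ t * n + 3 * n ≤ x ∧ x + p ≤ 2 * (t * n) + 7 * n := by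
  simp [FMinAbar]

/-- `FMinAll ⊆ range p`. -/
theorem fminAll_subset (t n p : ℕ) : FMinAll t n p ⊆ range p := by
  intro x hx
  simp only [FMinAll, mem_union, mem_fminA, mem_fminS, mem_fminAbar] at hx
  rw [mem_range]
  rcases hx with (h | h) | h
  · exact h.1
  · exact h.1
  · exact h.1

/-- `FMinA` and `FMinS` are disjoint. -/
theorem disjoint_fminA_fminS (t n p : ℕ) : Disjoint (FMinA t n p) (FMinS t n p) := by
  rw [Finset.disjoint_left]
  intro x hA hS
  rw [mem_fminA] at hA; rw [mem_fminS] at hS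
  omega

/-- `FMinA ∪ FMinS` and `FMinAbar` are disjoint (for `p < tn + 4n`). -/
theorem disjoint_fminAS_fminAbar {t n p : ℕ} (hp' : p < t * n + 4 * n) :
    Disjoint (FMinA t n p ∪ FMinS t n p) (FMinAbar t n p) := by
  rw [Finset.disjoint_left]
  intro x hAS hB
  rw [mem_union, mem_fminA, mem_fminS] at hAS; rw [mem_fminAbar] at hB
  omega

section MinExps

variable {t n p : ℕ} (ht : 4 ≤ t) (hp : t * n + 3 * n < p) (hp' : p < t * n + 4 * n)

include ht hp hp' in
/-- Net exponents of a class of `FMinA`: `(−1, −3)`, also for `b + e₇`; and the two-point shape data. -/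
theorem netExp_fminA {x : ℕ} (hx : x ∈ FMinA t n p) :
    netExp (bFam t n) x = -1 ∧ netExp (bFam t n) (x + p) = -3 ∧
    netExp (shift (bFam t n) 7) x = -1 ∧ netExp (shift (bFam t n) 7) (x + p) = -3 ∧
    x < p ∧ x + p ≤ 3 * (t * n) + 8 * n ∧ 3 * (t * n) + 8 * n < x + 2 * p := by
  rw [mem_fminA] at hx
  obtain ⟨hxp, h12, h27, h41⟩ := hx
  have h4 : 4 * n ≤ t * n := Nat.mul_le_mul_right n ht
  have e1 : netExp (bFam t n) x = -1 := by
    rw [netExp_bFam_of_ne t n x (by omega), depF_lower (k := 2) (by norm_num) (by norm_num) (by omega) (by omega)]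
    norm_num
  have e2 : netExp (bFam t n) (x + p) = -3 := by
    rw [netExp_bFam_of_ne t n (x + p) (by omega), depF_upper (k := 4) (by norm_num) (by norm_num) (by omega) (by omega)]
    norm_num
  refine ⟨e1, e2, ?_, ?_, hxp, by omega, h41⟩
  · rw [netExp_shiftF7 t n x (by omega) (by omega), e1]
  · rw [netExp_shiftF7 t n (x + p) (by omega) (by omega), e2]

include ht hp hp' in
/-- Net exponents of a class of `FMinS`: `(−2, −2)`, also for `b + e₇`; and the two-point shape data. -/
theorem netExp_fminS {x : ℕ} (hx : x ∈ FMinS t n p) :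
    netExp (bFam t n) x = -2 ∧ netExp (bFam t n) (x + p) = -2 ∧
    netExp (shift (bFam t n) 7) x = -2 ∧ netExp (shift (bFam t n) 7) (x + p) = -2 ∧
    x < p ∧ x + p ≤ 3 * (t * n) + 8 * n ∧ 3 * (t * n) + 8 * n < x + 2 * p := by
  rw [mem_fminS] at hx
  obtain ⟨hxp, h13, h28, -⟩ := hx
  have h4 : 4 * n ≤ t * n := Nat.mul_le_mul_right n ht
  have e1 : netExp (bFam t n) x = -2 := by
    rw [netExp_bFam_of_ne t n x (by omega), depF_lower (k := 3) (by norm_num) (by norm_num) (by omega) (by omega)]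
    norm_num
  have e2 : netExp (bFam t n) (x + p) = -2 := by
    rw [netExp_bFam_of_ne t n (x + p) (by omega), depF_upper (k := 3) (by norm_num) (by norm_num) (by omega) (by omega)]
    norm_num
  refine ⟨e1, e2, ?_, ?_, hxp, by omega, by omega⟩
  · rw [netExp_shiftF7 t n x (by omega) (by omega), e1]
  · rw [netExp_shiftF7 t n (x + p) (by omega) (by omega), e2]

end MinExps

/-- The conjugation `x ↦ b₀ − (x+p)` maps `FMinA` onto `FMinAbar` … -/
theorem conj_mem_fminAbar {t n p x : ℕ} (hx : x ∈ FMinA t n p) : 3 * (t * n) + 8 * n - (x + p) ∈ FMinAbar t n p := by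
  rw [mem_fminA] at hx; rw [mem_fminAbar]; omega

/-- … and `FMinAbar` back onto `FMinA` … -/
theorem conj_mem_fminA {t n p x : ℕ} (hp : t * n + 3 * n < p) (hx : x ∈ FMinAbar t n p) :
    3 * (t * n) + 8 * n - (x + p) ∈ FMinA t n p := by
  rw [mem_fminAbar] at hx; rw [mem_fminA]; omega

/-- … and `FMinS` onto itself. -/
theorem conj_mem_fminS {t n p x : ℕ} (hp : t * n + 3 * n < p) (hx : x ∈ FMinS t n p) :
    3 * (t * n) + 8 * n - (x + p) ∈ FMinS t n p := by
  rw [mem_fminS] at hx ⊢; omega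

end Summit.KontsevichZagierPeriods.Zeta5Search.CellA
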